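import Summits.QuantumFields.BalabanUV.Beta.SymCorrectorSlot
import Summits.QuantumFields.BalabanUV.Beta.SymCorrectorFaceDiv
import Summits.QuantumFields.BalabanUV.Beta.SymCorrectorFaceWeight
import Summits.QuantumFields.BalabanUV.Beta.SymCorrectorSockets
import Summits.QuantumFields.BalabanUV.Beta.GAN24.WSlotFirstDiff
import Summits.QuantumFields.BalabanUV.Beta.GAN24.KernelLegCharges

/-!
# `BalabanUV.Beta.GAN24.SymCorrectorZeroMode` — binder row G-an2-4 ∕ (CONV-C), TRANSFER-III (the (α-0) chain at row D1's literal of record (III′)), the (C)-row at the comb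
# data, STRUCTURAL LETTER (i) of the OWNER gan24-p1 g50's sizing memo `C-ROW-AT-COMB-SIZING-g50.md` §2: **THE SYMMETRISED CORRECTOR IS CHARGE-NEUTRAL — the slot transport
# `Ψ_Sᵀ` preserves slot totals, the leg conjugation `Ψ̂_Sᵀ ∘ · ∘ Ψ̂_S` preserves double-leg totals, and the four-slot transport `𝒯₄` of leaf-03's `CombLin4Transport` preserves
# the cell zero mode `zmode N` of every jointly `n`-covariant `LocStencil₂` table, in EVERY fibre block** — UNCONDITIONALLY (no slot-divergence letter is needed: the memo's
# caveat «a block sum of a divergence is a boundary flux, NOT zero in general» is met by periodicity — the flux of an `n`-periodic bond family through every `n`-block vanishes —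
# and, for the full-lattice slots and legs, by the zero total of all face fluxes).

NOT IN PRINT; OUR BOOKKEEPING (G-an2-4 crux team (2), leaf prover `b2b-balaban-gan24-formalise-leaf-01`, gen 84; [folklore] lattice-sum bookkeeping over d1-formalise-leaf-03's
typed objects `SymCorrectorForms.corrPsiS` ∕ `SymCorrectorKernel.psiKS` ∕ `SymCorrectorFace.faceWt ∕ faceSum ∕ slotPsiS` and leaf-02's `BiStencilZeroMode.zmode`, all BY NAME;
generic dimension `d+1`, block side `0 < n`, in-block root offset `r ∈ box (d+1) n`; 0 `def`, 0 cited facts, 0 `def … : Prop`, 0 sorry).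
HONEST FRAMING (cell contract, verbatim): «discharging `BetaPertH` makes Bałaban's UV stability UNCONDITIONAL — a real constructive-QFT result; it is NOT the continuum limit
and NOT the Clay problem.»  HONEST DEPENDENCY (verbatim): «continuum YM on T⁴ ⇐ BetaPertH ∧ nine spine estimates (0/9 proved); BetaPertH ⇐ (D1) ∧ (D4) ∧ CAP+tail; G-an2-4
gates asym, D1 and NE2/3/4.»

WHY.  After leaf-01 g83's PIN twin and the OWNER g50's `CombChargeConservationRow`, the G-an2-4 END at row D1's literal of record (III′) displays (b) the S-slot rows and (d′) «the
comb-chart `T₂` tower conserves its bond-symmetrised ff zero-mode charge».  The comb step is `lin4 c (unitK (GcombSh Lc j)) Lc`, `GcombSh Lc j = Ψ̂_S ∘ coDressKBmAt ρ_c Lc (KInvStep Lc j)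
∘ Ψ̂_Sᵀ` (an2's `CombChartTransportLevel.GcombSh_eq_conj_psiKS_KInvStep`), and leaf-03's (C-1) `CombLin4Transport.lin4_conj_psiKS` moves the conjugation onto the table: `lin4 c (Ψ̂_S ∘ K
∘ Ψ̂_Sᵀ) n T = lin4 c K n (𝒯₄ T)`, `𝒯₄ T κ₁ u₁ κ₂ u₂ := Ψ̂_Sᵀ ∘ slotPsiS r n (slotPsiS r n T κ₁ u₁) κ₂ u₂ ∘ Ψ̂_S`; so the bm-chart's (E) charge law (`T2RecChargeStep.zmode_succ_eq`) applies
to the TRANSPORTED member `𝒯₄ T̃′♮_j` at the centre root, and what the (III′) charge row needs beyond (E) is `zmode N (𝒯₄ T) = zmode N T` — one of the memo's two OPEN structural letters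
(«either may fail»).  It holds, unconditionally.

HOW ([folklore]).  `Ψ_S A = A + |box|⁻¹ • dz (ext n (ζ_S A))` differs from the identity by an EXACT, BLOCK-CONSTANT gauge term (TT1) — unlike the bm-chart's block-mean projector
`Πᵀ_bm` (gan24-p4 ∕ leaf-02's `CoProjSlotCharges`: «`𝔇` does NOT preserve the cell charge, it reads the FOUR-FACE charge») it moves NO charge: `slotPsiS r n T = T + faceWt • faceSum n T ∘ blk`
(TT3a), `faceSum n T Y = Σ_{x ∈ B(Y)} div T x` (TT7); (§2) the face sum of an `n`-PERIODIC family vanishes at every block (the box is a complete residue system — lit-balaban's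
`KKTFluctuationEnergy.sum_torus_eq_sum_box`), and the face sums of a SUMMABLE family total ZERO (block regrouping `tsum_blocks` of `Σ'_x div T x = 0`); (§3) the face family's total
factorises as `(Σ_{b ∈ box} faceWt α b) · Σ'_Y faceSum n T Y` (block covariance `faceWt_shift`), whence `Σ'_x slotPsiS r n T α x = Σ'_x T α x`; (§4) the legs of `Ψ̂_Sᵀ ∘ X ∘ Ψ̂_S` ARE slot
transports of the leg families (TT3b `comp_trK_psiKS_inl_left ∕ comp_psiKS_inl_right`), Fubini by leaf-04's `KernelLegCharges.summable_prod_of_biLoc`; (§5) on tables the series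
`Σ'_{u′} Σ'_x Σ'_z` commute with each transport (`tsum_slotPsiS_param`), the second slot is a slot total, and the first-slot transported family `k v ↦ Σ'_{u′xz} T k v κ′ u′ x z a b` is
`n`-periodic by joint covariance (leaf-02's `BiStencilZeroMode.inner_periodic`) — POINTWISE in the first bond, hence at every period `N`; the intermediate tables are `LocStencil₂` by TT5
`SymCorrectorSockets.locStencil₂_slotPsiS_outer ∕ _slotPsiS₂`.

WHAT.
* §1 `summable_comp_blk` (`Summable g ⟹ Summable (g ∘ blk n)`), `sum_box_add_eq_of_periodic`, `sum_blockSitesF_sub_eq_of_periodic`.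
* §2 **`faceSum_eq_zero_of_periodic`**, **`slotPsiS_eq_self_of_periodic`**; `summable_div`, `tsum_div_eq_zero`, `faceSum_eq_sum_box_div`, `summable_faceSum`, **`tsum_faceSum_eq_zero`**.
* §3 `slotPsiS_eq_add_mul_sum_sigma`, **`tsum_slotPsiS_param`**, `summable_faceWt_mul_faceSum`, `faceWt_block`, `tsum_faceWt_mul_comp_blk`, **`tsum_slotPsiS`**
  (`Σ'_x slotPsiS r n T α x = Σ'_x T α x`), `summable_slotPsiS`.
* §4 **`tsum_comp_trK_psiKS`**, **`tsum_comp_psiKS`** (one leg, every leg type), **`tsum_tsum_conj_psiKS`** (both legs, `BiLoc X`).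
* §5 `slotPsiS_apply_table`, `inner_conj_psiKS_eq`, `inner_slotPsiS_inner_eq`, `inner_slotPsiS_outer_eq`, **`inner_fourSlot_eq`** (pointwise in the first bond), **`zmode_fourSlot_eq`** ∕
  `zmode_fourSlot_eq'`: `zmode N (𝒯₄ T) κ κ′ a b = zmode N T κ κ′ a b` for every `N`, every direction pair, EVERY leg pair.
WHAT THIS IS NOT.  A letter about OUR typed corrector and OUR typed zero-mode functional; it asserts NO value of Bałaban's tables and NO value of any charge of the comb-chart tower;
it does NOT prove the conservation row (d′) (whose truth at the comb data is the OWNER's engine question E0), NOT the dressing defect `zmode_Lc (𝔇 Y) − zmode_Lc Y` of the transported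
member, NOT the memo's second letter (class-current symmetry under `slotPsiS`); the (III′) campaign is NOT asked (an2 W-4 l.64553) — zero weight; NEVER «G-an2-4 closed» as (CONV-C);
NOT D1, NOT `BetaPertH`, NOT continuum, NOT Clay; not in print.  `bears_on: R4-G`.  2026-08-27.
-/

noncomputable section

open Finset
open scoped BigOperators
open Literature.Probability.LatticeModels (TorusSite Torus.proj Torus.proj_apply)
open Literature.MathematicalPhysics.QuantumFieldTheory
open Literature.MathematicalPhysics.QuantumFieldTheory.Balaban1983to89
open Literature.MathematicalPhysics.QuantumFieldTheory.Balaban1983to89.Beta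
open LatticeForm (repZ)
open BlochFibreMatrix (eq_repZ_add_zsmul_quo)
open KKTFluctuationEnergy (sum_torus_eq_sum_box tsum_blocks summable_blocks)
open ExpKernelCalculus (MKer BiLoc comp shiftK)
open OneStepResolventKernel (Fib)
open AffineAveraging (Site Form1 box toSite unitVec)
open AveragingContours (blk blk_block)
open BalabanCompositeJets (LocStencil₂)
open Summit.QuantumFields.BalabanUV.Beta.TameKernelCalculus (trK)
open Summit.QuantumFields.BalabanUV.Beta.KernelWardRelative (gaugeWt)
open Summit.QuantumFields.BalabanUV.Beta.CompositeCorrectorLocality (blockSitesF mem_blockSitesF_of_blk_eq)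
open Summit.QuantumFields.BalabanUV.Beta.SymCorrectorKernel (psiKS)
open Summit.QuantumFields.BalabanUV.Beta.SymCorrectorFace (faceWt faceWtSum faceWtSum_nonneg abs_faceWt_le faceWt_shift gaugeWt_eq bondNbhd
  faceSum faceSum_eq_sum_sigma slotPsiS slotPsiS_apply_kernel card_blockSitesF)
open Summit.QuantumFields.BalabanUV.Beta.SymCorrectorFaceDiv (faceSum_eq_blockSum_div)
open Summit.QuantumFields.BalabanUV.Beta.SymCorrectorFaceWeight (sum_blockSitesF_eq_sum_box)
open Summit.QuantumFields.BalabanUV.Beta.SymCorrectorSlot (comp_trK_psiKS_inl_left comp_trK_psiKS_inr_left comp_psiKS_inl_right comp_psiKS_inr_right)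

namespace Summit.QuantumFields.BalabanUV.Beta.GAN24.SymCorrectorZeroMode

variable {d : ℕ} {n : ℕ} (hn : 0 < n)
include hn

/-! ## §1 Lattice bookkeeping: block pull-backs are summable; box sums of periodic functions are translation invariant -/

/-- [folklore] **THE BLOCK PULL-BACK OF A SUMMABLE COARSE FUNCTION IS SUMMABLE**: `Summable g ⟹ Summable (x ↦ g (blk n x))` (each coarse value is
repeated on the `n^{d+1}` sites of its block). -/
theorem summable_comp_blk {g : Site (d + 1) → ℝ} (hg : Summable g) : Summable fun x : Site (d + 1) => g (blk n x) := by
  classical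
  refine Summable.of_abs (summable_of_sum_le (c := (n : ℝ) ^ (d + 1) * ∑' Y, |g Y|) (fun _ => abs_nonneg _) fun s => ?_)
  rw [← Finset.sum_fiberwise_of_maps_to (fun x hx => Finset.mem_image_of_mem (blk n) hx) fun x => |g (blk n x)|]
  calc ∑ Y ∈ s.image (blk n), ∑ x ∈ s with blk n x = Y, |g (blk n x)|
      = ∑ Y ∈ s.image (blk n), ((s.filter fun x => blk n x = Y).card : ℝ) * |g Y| := by
        refine Finset.sum_congr rfl fun Y _ => ?_
        rw [Finset.sum_congr rfl fun x hx => by rw [(Finset.mem_filter.1 hx).2], Finset.sum_const, nsmul_eq_mul]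
    _ ≤ ∑ Y ∈ s.image (blk n), (n : ℝ) ^ (d + 1) * |g Y| := by
        refine Finset.sum_le_sum fun Y _ => mul_le_mul_of_nonneg_right ?_ (abs_nonneg _)
        have h : (s.filter fun x => blk n x = Y).card ≤ (blockSitesF n Y).card :=
          Finset.card_le_card fun x hx => mem_blockSitesF_of_blk_eq hn (Finset.mem_filter.1 hx).2
        rw [card_blockSitesF] at h; exact_mod_cast h
    _ = (n : ℝ) ^ (d + 1) * ∑ Y ∈ s.image (blk n), |g Y| := by rw [Finset.mul_sum]
    _ ≤ (n : ℝ) ^ (d + 1) * ∑' Y, |g Y| := mul_le_mul_of_nonneg_left (hg.abs.sum_le_tsum _ fun _ _ => abs_nonneg _) (by positivity)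

/-- [folklore] **A BOX SUM OF AN `n`-PERIODIC FUNCTION IS TRANSLATION INVARIANT**: `Σ_{b ∈ box} g (b + v) = Σ_{b ∈ box} g b` for every `v` (the box is a
complete residue system of `ℤ^{d+1} ∕ n•ℤ^{d+1}`; read on the torus `(ℤ∕n)^{d+1}` the translation is a bijection). -/
theorem sum_box_add_eq_of_periodic {g : Site (d + 1) → ℝ} (hper : ∀ x t : Site (d + 1), g (x + (n : ℤ) • t) = g x) (v : Site (d + 1)) :
    ∑ b ∈ box (d + 1) n, g (toSite b + v) = ∑ b ∈ box (d + 1) n, g (toSite b) := by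
  haveI : NeZero n := ⟨hn.ne'⟩
  have hrep : ∀ x : Site (d + 1), g x = g (repZ (Torus.proj n x)) := fun x => by
    conv_lhs => rw [eq_repZ_add_zsmul_quo (N := n) x]
    exact hper _ _
  rw [← sum_torus_eq_sum_box (N := n) (fun x => g (x + v)), ← sum_torus_eq_sum_box (N := n) g]
  have e : ∀ z : TorusSite (d + 1) n, g (repZ z + v) = g (repZ (z + Torus.proj n v)) := fun z => by
    rw [hrep (repZ z + v)]; congr 2; funext j; simp [Torus.proj_apply, repZ]
  simp only [e]
  exact Fintype.sum_equiv (Equiv.addRight (Torus.proj n v)) _ _ fun z => rfl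

/-- [folklore] **… HENCE A BLOCK SUM OF AN `n`-PERIODIC FUNCTION DOES NOT SEE A TRANSLATION**: `Σ_{x ∈ blockSitesF n Y} g (x − e) = Σ_{x ∈ blockSitesF n Y} g x`. -/
theorem sum_blockSitesF_sub_eq_of_periodic {g : Site (d + 1) → ℝ} (hper : ∀ x t : Site (d + 1), g (x + (n : ℤ) • t) = g x)
    (Y e : Site (d + 1)) : ∑ x ∈ blockSitesF n Y, g (x - e) = ∑ x ∈ blockSitesF n Y, g x := by
  rw [sum_blockSitesF_eq_sum_box hn (fun x => g (x - e)) Y, sum_blockSitesF_eq_sum_box hn g Y]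
  have h1 : ∀ b : Fin (d + 1) → ℕ, g ((n : ℤ) • Y + toSite b - e) = g (toSite b + -e) := fun b => by
    rw [show (n : ℤ) • Y + toSite b - e = (toSite b + -e) + (n : ℤ) • Y by abel, hper]
  have h2 : ∀ b : Fin (d + 1) → ℕ, g ((n : ℤ) • Y + toSite b) = g (toSite b) := fun b => by rw [add_comm, hper]
  simp only [h1, h2]
  exact sum_box_add_eq_of_periodic hn hper (-e)

/-! ## §2 The face sum: an `n`-periodic family has NO face sum; the face sums of a summable family have ZERO total -/

/-- [folklore] **THE FLUX OF AN `n`-PERIODIC BOND FAMILY THROUGH EVERY BLOCK VANISHES**: `(∀ κ x t, T κ (x + n•t) = T κ x) ⟹ faceSum n T Y = 0`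
(TT7 `faceSum_eq_blockSum_div`: the face sum is the block sum of the divergences, and each block sum `Σ_{x ∈ B(Y)} T κ (x − e_κ)` of a periodic family equals
`Σ_{x ∈ B(Y)} T κ x`). -/
theorem faceSum_eq_zero_of_periodic {T : Form1 (d + 1) ℝ} (hper : ∀ (κ : Fin (d + 1)) (x t : Site (d + 1)), T κ (x + (n : ℤ) • t) = T κ x)
    (Y : Site (d + 1)) : faceSum n T Y = 0 := by
  rw [faceSum_eq_blockSum_div hn, Finset.sum_comm]
  refine Finset.sum_eq_zero fun κ _ => ?_
  rw [Finset.sum_sub_distrib, sum_blockSitesF_sub_eq_of_periodic hn (hper κ) Y (unitVec κ), sub_self]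

/-- [folklore] **THE SLOT TRANSPORT `Ψ_Sᵀ` FIXES `n`-PERIODIC BOND FAMILIES**: `slotPsiS r n T = T` (no face family). -/
theorem slotPsiS_eq_self_of_periodic (r : Fin (d + 1) → ℕ) {T : Form1 (d + 1) ℝ}
    (hper : ∀ (κ : Fin (d + 1)) (x t : Site (d + 1)), T κ (x + (n : ℤ) • t) = T κ x) : slotPsiS r n T = T := by
  funext α x
  show T α x + faceWt r n α x • faceSum n T (blk n x) = T α x
  rw [faceSum_eq_zero_of_periodic hn hper, smul_zero, add_zero]

omit hn in
/-- [folklore] A translate of a summable bond component is summable. -/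
theorem summable_sub_unitVec {T : Form1 (d + 1) ℝ} (hT : ∀ κ, Summable (T κ)) (κ : Fin (d + 1)) :
    Summable fun x : Site (d + 1) => T κ (x - unitVec κ) :=
  (Equiv.subRight (unitVec κ)).summable_iff.2 (hT κ)

omit hn in
/-- [folklore] The divergence of a bond family with summable components is summable. -/
theorem summable_div {T : Form1 (d + 1) ℝ} (hT : ∀ κ, Summable (T κ)) :
    Summable fun x : Site (d + 1) => ∑ κ : Fin (d + 1), (T κ (x - unitVec κ) - T κ x) :=
  summable_sum fun κ _ => (summable_sub_unitVec hT κ).sub (hT κ)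

omit hn in
/-- [folklore] … and has ZERO total: `Σ'_x Σ_κ (T κ (x − e_κ) − T κ x) = 0` (each translate has the same sum). -/
theorem tsum_div_eq_zero {T : Form1 (d + 1) ℝ} (hT : ∀ κ, Summable (T κ)) :
    ∑' x : Site (d + 1), ∑ κ : Fin (d + 1), (T κ (x - unitVec κ) - T κ x) = 0 := by
  rw [Summable.tsum_finsetSum fun κ _ => (summable_sub_unitVec hT κ).sub (hT κ)]
  refine Finset.sum_eq_zero fun κ _ => ?_
  rw [(summable_sub_unitVec hT κ).tsum_sub (hT κ), sub_eq_zero]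
  exact (Equiv.subRight (unitVec κ)).tsum_eq (T κ)

/-- [folklore] **THE FACE SUM AS A BOX-INDEXED BLOCK SUM OF THE DIVERGENCE**: `faceSum n T Y = Σ_{b ∈ box} div T (n•Y + b)`. -/
theorem faceSum_eq_sum_box_div (T : Form1 (d + 1) ℝ) (Y : Site (d + 1)) :
    faceSum n T Y = ∑ b ∈ box (d + 1) n, ∑ κ : Fin (d + 1), (T κ ((n : ℤ) • Y + toSite b - unitVec κ) - T κ ((n : ℤ) • Y + toSite b)) := by
  rw [faceSum_eq_blockSum_div hn]
  exact sum_blockSitesF_eq_sum_box hn (fun x => ∑ κ : Fin (d + 1), (T κ (x - unitVec κ) - T κ x)) Y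

/-- [folklore] **THE FACE SUMS OF A SUMMABLE FAMILY ARE SUMMABLE OVER THE BLOCKS.** -/
theorem summable_faceSum {T : Form1 (d + 1) ℝ} (hT : ∀ κ, Summable (T κ)) : Summable fun Y : Site (d + 1) => faceSum n T Y := by
  haveI : NeZero n := ⟨hn.ne'⟩
  refine (summable_blocks (N := n) (summable_div hT)).congr fun Y => ?_
  rw [faceSum_eq_sum_box_div hn T Y]

/-- [folklore] **THE FACE SUMS OF A SUMMABLE FAMILY HAVE ZERO TOTAL**: `Σ'_Y faceSum n T Y = 0` — every face-crossing bond enters one block and leaves another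
(block regrouping `KKTFluctuationEnergy.tsum_blocks` of the zero total `tsum_div_eq_zero`). -/
theorem tsum_faceSum_eq_zero {T : Form1 (d + 1) ℝ} (hT : ∀ κ, Summable (T κ)) : ∑' Y : Site (d + 1), faceSum n T Y = 0 := by
  haveI : NeZero n := ⟨hn.ne'⟩
  rw [tsum_congr fun Y => faceSum_eq_sum_box_div hn _ Y]
  exact ((tsum_blocks (N := n) (summable_div hT)).symm.trans (tsum_div_eq_zero hT) : _)

/-! ## §3 The slot transport `Ψ_Sᵀ` preserves slot TOTALS -/

omit hn in
/-- [folklore] `slotPsiS` as ONE finite combination: `slotPsiS r n T α x = T α x + faceWt α x · Σ_{⟨κ′,u⟩ ∈ univ.sigma (bondNbhd n (blk x))} gaugeWt (blk x) κ′ u · T κ′ u`. -/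
theorem slotPsiS_eq_add_mul_sum_sigma (r : Fin (d + 1) → ℕ) (T : Form1 (d + 1) ℝ) (α : Fin (d + 1)) (x : Site (d + 1)) :
    slotPsiS r n T α x = T α x + faceWt r n α x *
      ∑ s ∈ (Finset.univ : Finset (Fin (d + 1))).sigma (bondNbhd n (blk n x)), gaugeWt n (blk n x) s.1 s.2 * T s.1 s.2 := by
  show T α x + faceWt r n α x • faceSum n T (blk n x) = _
  rw [faceSum_eq_sum_sigma, smul_eq_mul]
  simp only [smul_eq_mul]

omit hn in
/-- [folklore] **THE SLOT TRANSPORT COMMUTES WITH A CONVERGENT SERIES OF BOND FAMILIES** (it is a FINITE linear combination of evaluations with family-independent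
coefficients): `Σ'_i slotPsiS r n (F i) α x = slotPsiS r n (κ u ↦ Σ'_i F i κ u) α x` whenever every `i ↦ F i κ u` is summable. -/
theorem tsum_slotPsiS_param {ι : Type*} (r : Fin (d + 1) → ℕ) {F : ι → Form1 (d + 1) ℝ} (hF : ∀ κ u, Summable fun i => F i κ u)
    (α : Fin (d + 1)) (x : Site (d + 1)) :
    ∑' i, slotPsiS r n (F i) α x = slotPsiS r n (fun κ u => ∑' i, F i κ u) α x := by
  classical
  simp only [slotPsiS_eq_add_mul_sum_sigma]
  have hs : ∀ s : (κ : Fin (d + 1)) × Site (d + 1), Summable fun i => gaugeWt n (blk n x) s.1 s.2 * F i s.1 s.2 := fun s => (hF _ _).mul_left _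
  have hS : Summable fun i => ∑ s ∈ (Finset.univ : Finset (Fin (d + 1))).sigma (bondNbhd n (blk n x)), gaugeWt n (blk n x) s.1 s.2 * F i s.1 s.2 :=
    summable_sum fun s _ => hs s
  rw [(hF α x).tsum_add (hS.mul_left _), tsum_mul_left, Summable.tsum_finsetSum fun s _ => hs s]
  simp only [tsum_mul_left]

/-- [folklore] The face family `x ↦ faceWt r n α x · faceSum n T (blk n x)` of a summable family is summable (`|faceWt| ≤ faceWtSum`, §1–§2). -/
theorem summable_faceWt_mul_faceSum (r : Fin (d + 1) → ℕ) {T : Form1 (d + 1) ℝ} (hT : ∀ κ, Summable (T κ)) (α : Fin (d + 1)) :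
    Summable fun x : Site (d + 1) => faceWt r n α x * faceSum n T (blk n x) := by
  refine Summable.of_norm_bounded (((summable_comp_blk hn (summable_faceSum hn hT)).abs).mul_left (faceWtSum r n)) fun x => ?_
  rw [Real.norm_eq_abs, abs_mul]
  exact mul_le_mul_of_nonneg_right (abs_faceWt_le hn r α x) (abs_nonneg _)

omit hn in
/-- [folklore] Block covariance of the face weight, box-indexed form: `faceWt α (n•t + b) = faceWt α b`. -/
theorem faceWt_block {n : ℕ} (hn : 0 < n) (r : Fin (d + 1) → ℕ) (α : Fin (d + 1)) (t : Site (d + 1)) (b : Fin (d + 1) → ℕ) :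
    faceWt r n α ((n : ℤ) • t + toSite b) = faceWt r n α (toSite b) := by
  rw [add_comm, faceWt_shift hn]

/-- [folklore] **A FACE-WEIGHTED SUM OF A BLOCK FUNCTION FACTORISES**: `Σ'_x faceWt α x · g (blk x) = (Σ_{b ∈ box} faceWt α b) · Σ'_Y g Y` whenever the left series converges
(cell decomposition, block covariance of the face weight). -/
theorem tsum_faceWt_mul_comp_blk (r : Fin (d + 1) → ℕ) (α : Fin (d + 1)) {g : Site (d + 1) → ℝ}
    (hfg : Summable fun x : Site (d + 1) => faceWt r n α x * g (blk n x)) :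
    ∑' x, faceWt r n α x * g (blk n x) = (∑ b ∈ box (d + 1) n, faceWt r n α (toSite b)) * ∑' Y, g Y := by
  haveI : NeZero n := ⟨hn.ne'⟩
  rw [BiStencilZeroMode.tsum_eq_sum_box_tsum (N := n) hfg, Finset.sum_mul]
  refine Finset.sum_congr rfl fun b hb => ?_
  simp only [faceWt_block hn, blk_block _ hb]
  exact tsum_mul_left

/-- [folklore] **THE SLOT TRANSPORT `Ψ_Sᵀ` PRESERVES SLOT TOTALS**: for a bond family with summable components, `Σ'_x slotPsiS r n T α x = Σ'_x T α x` — the face family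
`faceWt • faceSum` has zero total (every block's face sum is weighted by the SAME box total of face weights, and the face sums themselves total zero).  Contrast
`CoProjSlotCharges.tsum_coProjBmAt_eq_face`: the bm-chart's `Πᵀ_bm` reads `N ×` a face instead. -/
theorem tsum_slotPsiS (r : Fin (d + 1) → ℕ) {T : Form1 (d + 1) ℝ} (hT : ∀ κ, Summable (T κ)) (α : Fin (d + 1)) :
    ∑' x, slotPsiS r n T α x = ∑' x, T α x := by
  have e : ∀ x, slotPsiS r n T α x = T α x + faceWt r n α x * faceSum n T (blk n x) := fun x => rfl
  rw [tsum_congr e, (hT α).tsum_add (summable_faceWt_mul_faceSum hn r hT α),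
    tsum_faceWt_mul_comp_blk hn r α (summable_faceWt_mul_faceSum hn r hT α), tsum_faceSum_eq_zero hn hT,
    mul_zero, add_zero]

/-- [folklore] … and the transported family has summable components. -/
theorem summable_slotPsiS (r : Fin (d + 1) → ℕ) {T : Form1 (d + 1) ℝ} (hT : ∀ κ, Summable (T κ)) (α : Fin (d + 1)) :
    Summable fun x => slotPsiS r n T α x :=
  ((hT α).add (summable_faceWt_mul_faceSum hn r hT α)).congr fun _ => rfl

/-! ## §4 The kernel legs: conjugation by `Ψ̂_S` preserves the leg totals of a localised kernel (every leg type) -/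

section Legs

variable {r : Fin (d + 1) → ℕ} (hr : r ∈ box (d + 1) n)
include hr

/-- [folklore] **LEFT LEG**: `Σ'_x (Ψ̂_Sᵀ ∘ X)(x, w)_{a b} = Σ'_x X(x, w)_{a b}` for every leg type `a` (field leg: TT3b `comp_trK_psiKS_inl_left` makes it the slot transport of the summable family
`κ u ↦ X(u, w)_{inl κ, b}`, then §3; multiplier leg untouched). -/
theorem tsum_comp_trK_psiKS (X : MKer (d + 1) (Fib d)) (w : Site (d + 1)) (a b : Fib d) (hX : ∀ a' : Fib d, Summable fun u => X u w a' b) :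
    ∑' x, comp (trK (psiKS r n)) X x w a b = ∑' x, X x w a b := by
  rcases a with β | m
  · rw [tsum_congr fun x => comp_trK_psiKS_inl_left hn hr X x w β b]
    exact tsum_slotPsiS hn r (T := fun κ u => X u w (Sum.inl κ) b) (fun κ => hX (Sum.inl κ)) β
  · exact tsum_congr fun x => comp_trK_psiKS_inr_left X x w m b

/-- [folklore] **RIGHT LEG**: `Σ'_w (X ∘ Ψ̂_S)(x, w)_{a b} = Σ'_w X(x, w)_{a b}` for every leg type `b`. -/
theorem tsum_comp_psiKS (X : MKer (d + 1) (Fib d)) (x : Site (d + 1)) (a b : Fib d) (hX : ∀ b' : Fib d, Summable fun w => X x w a b') :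
    ∑' w, comp X (psiKS r n) x w a b = ∑' w, X x w a b := by
  rcases b with β | m
  · rw [tsum_congr fun w => comp_psiKS_inl_right hn hr X x w a β]
    exact tsum_slotPsiS hn r (T := fun κ u => X x u a (Sum.inl κ)) (fun κ => hX (Sum.inl κ)) β
  · exact tsum_congr fun w => comp_psiKS_inr_right X x w a m

/-- [folklore] **BOTH LEGS: THE `Ψ̂_S`-CONJUGATE OF A LOCALISED KERNEL HAS THE SAME DOUBLE-LEG TOTAL** — `Σ'_x Σ'_z (Ψ̂_Sᵀ ∘ X ∘ Ψ̂_S)(x, z)_{a b} = Σ'_x Σ'_z X(x, z)_{a b}`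
(`BiLoc X`, rate `δ > 0`, every leg type).  Contrast gan24-p4 ∕ leaf-02's `CoProjSlotCharges.tsum_tsum_dressKBmAt_inl_inl_eq_face` («the bm dressing does NOT preserve the double-leg
total»): the symmetrised corrector `Ψ_S = 1 + |box|⁻¹·dz ∘ ext ∘ ζ_S` differs from `1` by an exact block-constant gauge term and is CHARGE-NEUTRAL. -/
theorem tsum_tsum_conj_psiKS {X : MKer (d + 1) (Fib d)} {p q : Site (d + 1)} {C δ : ℝ} (hX : BiLoc X p q C δ) (hδ : 0 < δ) (a b : Fib d) :
    ∑' x, ∑' z, comp (comp (trK (psiKS r n)) X) (psiKS r n) x z a b = ∑' x, ∑' z, X x z a b := by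
  obtain ⟨p', q', C', δ', hδ', hV⟩ := (SymCorrectorKernel.spr_psiKS hn hr).trK.comp_loc ⟨p, q, C, δ, hδ, hX⟩
  have h1 : ∀ x, ∑' z, comp (comp (trK (psiKS r n)) X) (psiKS r n) x z a b = ∑' z, comp (trK (psiKS r n)) X x z a b :=
    fun x => tsum_comp_psiKS hn hr _ x a b fun b' => AxialDressing.summable_row_of_biLoc hV hδ' x a b'
  have hVs : Summable (Function.uncurry fun x z => comp (trK (psiKS r n)) X x z a b) := KernelLegCharges.summable_prod_of_biLoc hV hδ' a b
  have hXs : Summable (Function.uncurry fun x z => X x z a b) := KernelLegCharges.summable_prod_of_biLoc hX hδ a b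
  rw [tsum_congr h1, ← hVs.tsum_comm, tsum_congr fun z => tsum_comp_trK_psiKS hn hr X z a b fun a' => AxialDressing.summable_col_of_biLoc hX hδ z a' b,
    hXs.tsum_comm]

end Legs

/-! ## §5 Bi-stencil tables: the four-slot transport `𝒯₄` is ZERO-MODE NEUTRAL -/

section Tables

variable {T : Fin (d + 1) → Site (d + 1) → Fin (d + 1) → Site (d + 1) → MKer (d + 1) (Fib d)} {CT δT : ℝ}

omit hn in
/-- [folklore] Evaluation commutes with the OUTER slot transport of a bi-stencil table: `(slotPsiS r n T κ u) κ′ u′ x z a b = slotPsiS r n (k v ↦ T k v κ′ u′ x z a b) κ u`. -/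
theorem slotPsiS_apply_table (r : Fin (d + 1) → ℕ) (T : Fin (d + 1) → Site (d + 1) → Fin (d + 1) → Site (d + 1) → MKer (d + 1) (Fib d))
    (κ : Fin (d + 1)) (u : Site (d + 1)) (κ' : Fin (d + 1)) (u' x z : Site (d + 1)) (a b : Fib d) :
    slotPsiS r n T κ u κ' u' x z a b = slotPsiS r n (fun k v => T k v κ' u' x z a b) κ u := by
  simp only [slotPsiS, faceSum, Finset.sum_apply, Pi.add_apply, Pi.smul_apply, smul_eq_mul]

/-- [folklore] **THE LEG CONJUGATION IS CHARGE-NEUTRAL ON TABLES** (pointwise in the first bond): for a `LocStencil₂` table (rate `δ > 0`),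
`Σ'_{u′} Σ'_x Σ'_z (Ψ̂_Sᵀ ∘ S κ u κ′ u′ ∘ Ψ̂_S) x z a b = Σ'_{u′} Σ'_x Σ'_z S κ u κ′ u′ x z a b`. -/
theorem inner_conj_psiKS_eq {r : Fin (d + 1) → ℕ} (hr : r ∈ box (d + 1) n) (hT : LocStencil₂ T CT δT) (hδT : 0 < δT)
    (κ : Fin (d + 1)) (u : Site (d + 1)) (κ' : Fin (d + 1)) (a b : Fib d) :
    (∑' u', ∑' x, ∑' z, comp (comp (trK (psiKS r n)) (T κ u κ' u')) (psiKS r n) x z a b) = ∑' u', ∑' x, ∑' z, T κ u κ' u' x z a b :=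
  tsum_congr fun u' => tsum_tsum_conj_psiKS hn hr (hT κ u κ' u') hδT a b

/-- [folklore] **THE INNER (second-slot) TRANSPORT IS CHARGE-NEUTRAL ON TABLES**: for a `LocStencil₂` table,
`Σ'_{u′} Σ'_x Σ'_z (slotPsiS r n (S κ u) κ′ u′) x z a b = Σ'_{u′} Σ'_x Σ'_z S κ u κ′ u′ x z a b` (the two kernel series commute with the transport, §3 `tsum_slotPsiS_param`;
the second-slot series is a slot total, §3 `tsum_slotPsiS`). -/
theorem inner_slotPsiS_inner_eq (r : Fin (d + 1) → ℕ) (hT : LocStencil₂ T CT δT) (hδT : 0 < δT)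
    (κ : Fin (d + 1)) (u : Site (d + 1)) (κ' : Fin (d + 1)) (a b : Fib d) :
    (∑' u', ∑' x, ∑' z, slotPsiS r n (T κ u) κ' u' x z a b) = ∑' u', ∑' x, ∑' z, T κ u κ' u' x z a b := by
  have hz : ∀ u' x, (∑' z, slotPsiS r n (T κ u) κ' u' x z a b) = slotPsiS r n (fun k v => ∑' z, T κ u k v x z a b) κ' u' := by
    intro u' x
    rw [tsum_congr fun z => slotPsiS_apply_kernel r n (T κ u) κ' u' x z a b]
    exact tsum_slotPsiS_param r (F := fun z k v => T κ u k v x z a b) (fun k v => AxialDressing.summable_row_of_biLoc (hT κ u k v) hδT x a b) κ' u'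
  have hx : ∀ u', (∑' x, ∑' z, slotPsiS r n (T κ u) κ' u' x z a b) = slotPsiS r n (fun k v => ∑' x, ∑' z, T κ u k v x z a b) κ' u' := by
    intro u'
    rw [tsum_congr (hz u')]
    exact tsum_slotPsiS_param r (F := fun x k v => ∑' z, T κ u k v x z a b) (fun k v => WSlotFirstDiff.summable_xz (hT κ u k v) hδT a b) κ' u'
  rw [tsum_congr hx]
  exact tsum_slotPsiS hn r (T := fun k v => ∑' x, ∑' z, T κ u k v x z a b) (fun k => WSlotFirstDiff.summable_u'xz hT hδT κ u k a b) κ'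

/-- [folklore] **THE OUTER (first-slot) TRANSPORT IS CHARGE-NEUTRAL ON JOINTLY `n`-COVARIANT `LocStencil₂` TABLES — POINTWISE IN THE FIRST BOND**:
`Σ'_{u′} Σ'_x Σ'_z (slotPsiS r n T κ u) κ′ u′ x z a b = Σ'_{u′} Σ'_x Σ'_z T κ u κ′ u′ x z a b` for EVERY `u` (the three series commute with the transport; the transported scalar family
`k v ↦ Σ'_{u′xz} T k v κ′ u′ x z a b` is `n`-PERIODIC — leaf-02's `BiStencilZeroMode.inner_periodic` — and a periodic family has no face family, §2). -/
theorem inner_slotPsiS_outer_eq (r : Fin (d + 1) → ℕ) (hT : LocStencil₂ T CT δT) (hδT : 0 < δT)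
    (hTcov : ∀ κ u κ' u' t, T κ (u + (n : ℤ) • t) κ' (u' + (n : ℤ) • t) = shiftK (-((n : ℤ) • t)) (T κ u κ' u'))
    (κ : Fin (d + 1)) (u : Site (d + 1)) (κ' : Fin (d + 1)) (a b : Fib d) :
    (∑' u', ∑' x, ∑' z, slotPsiS r n T κ u κ' u' x z a b) = ∑' u', ∑' x, ∑' z, T κ u κ' u' x z a b := by
  have hz : ∀ u' x, (∑' z, slotPsiS r n T κ u κ' u' x z a b) = slotPsiS r n (fun k v => ∑' z, T k v κ' u' x z a b) κ u := by
    intro u' x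
    rw [tsum_congr fun z => slotPsiS_apply_table r T κ u κ' u' x z a b]
    exact tsum_slotPsiS_param r (F := fun z k v => T k v κ' u' x z a b) (fun k v => AxialDressing.summable_row_of_biLoc (hT k v κ' u') hδT x a b) κ u
  have hx : ∀ u', (∑' x, ∑' z, slotPsiS r n T κ u κ' u' x z a b) = slotPsiS r n (fun k v => ∑' x, ∑' z, T k v κ' u' x z a b) κ u := by
    intro u'
    rw [tsum_congr (hz u')]
    exact tsum_slotPsiS_param r (F := fun x k v => ∑' z, T k v κ' u' x z a b) (fun k v => WSlotFirstDiff.summable_xz (hT k v κ' u') hδT a b) κ u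
  rw [tsum_congr hx, tsum_slotPsiS_param r (F := fun u' k v => ∑' x, ∑' z, T k v κ' u' x z a b)
    (fun k v => WSlotFirstDiff.summable_u'xz hT hδT k v κ' a b) κ u,
    slotPsiS_eq_self_of_periodic hn r (T := fun k v => ∑' u', ∑' x, ∑' z, T k v κ' u' x z a b)
      fun k v t => BiStencilZeroMode.inner_periodic hTcov k κ' a b v t]

/-- **THE FOUR-SLOT TRANSPORT `𝒯₄` IS CHARGE-NEUTRAL, POINTWISE IN THE FIRST BOND** [our bookkeeping; folklore composition] (`0 < n`, `r ∈ box (d+1) n`, `Ψ̂ = psiKS r n`, a `LocStencil₂`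
jointly `n`-covariant table `T`, every leg type; `𝒯₄ T κ₁ u₁ κ₂ u₂ := Ψ̂ᵀ ∘ slotPsiS r n (slotPsiS r n T κ₁ u₁) κ₂ u₂ ∘ Ψ̂`, the table of leaf-03's `CombLin4Transport.lin4_conj_psiKS`):
`Σ'_{u′} Σ'_x Σ'_z 𝒯₄ T κ u κ′ u′ x z a b = Σ'_{u′} Σ'_x Σ'_z T κ u κ′ u′ x z a b` for EVERY `u` (legs ⨾ inner slot ⨾ outer slot; intermediate shapes by TT5 `SymCorrectorSockets`). -/
theorem inner_fourSlot_eq {r : Fin (d + 1) → ℕ} (hr : r ∈ box (d + 1) n) (hT : LocStencil₂ T CT δT) (hδT : 0 < δT)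
    (hTcov : ∀ κ u κ' u' t, T κ (u + (n : ℤ) • t) κ' (u' + (n : ℤ) • t) = shiftK (-((n : ℤ) • t)) (T κ u κ' u'))
    (κ : Fin (d + 1)) (u : Site (d + 1)) (κ' : Fin (d + 1)) (a b : Fib d) :
    (∑' u', ∑' x, ∑' z, comp (comp (trK (psiKS r n)) (slotPsiS r n (slotPsiS r n T κ u) κ' u')) (psiKS r n) x z a b)
      = ∑' u', ∑' x, ∑' z, T κ u κ' u' x z a b := by
  have hP₁ := SymCorrectorSockets.locStencil₂_slotPsiS_outer hn r hT hδT.le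
  have hP₂ := SymCorrectorSockets.locStencil₂_slotPsiS₂ hn r hT hδT.le
  calc (∑' u', ∑' x, ∑' z, comp (comp (trK (psiKS r n)) (slotPsiS r n (slotPsiS r n T κ u) κ' u')) (psiKS r n) x z a b)
      = ∑' u', ∑' x, ∑' z, slotPsiS r n (slotPsiS r n T κ u) κ' u' x z a b := inner_conj_psiKS_eq hn hr hP₂ hδT κ u κ' a b
    _ = ∑' u', ∑' x, ∑' z, slotPsiS r n T κ u κ' u' x z a b := inner_slotPsiS_inner_eq hn r hP₁ hδT κ u κ' a b
    _ = ∑' u', ∑' x, ∑' z, T κ u κ' u' x z a b := inner_slotPsiS_outer_eq hn r hT hδT hTcov κ u κ' a b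

/-- **THE FOUR-SLOT TRANSPORT `𝒯₄` IS ZERO-MODE NEUTRAL** [our bookkeeping; folklore composition]: for every period `N`, every bond-direction pair and EVERY leg pair,
`zmode N (𝒯₄ T) κ κ′ a b = zmode N T κ κ′ a b` (`0 < n`, `r ∈ box (d+1) n`, `T` a `LocStencil₂` jointly `n`-covariant table) — the structural letter the (III′) charge row asks of the comb
chart's table transport (the `lin4` step through `Ψ̂_S ∘ K ∘ Ψ̂_Sᵀ` is the `lin4` step through `K` on `𝒯₄ T`, `CombLin4Transport.lin4_conj_psiKS`): the transport changes NO cell charge. -/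
theorem zmode_fourSlot_eq {r : Fin (d + 1) → ℕ} (hr : r ∈ box (d + 1) n) (hT : LocStencil₂ T CT δT) (hδT : 0 < δT)
    (hTcov : ∀ κ u κ' u' t, T κ (u + (n : ℤ) • t) κ' (u' + (n : ℤ) • t) = shiftK (-((n : ℤ) • t)) (T κ u κ' u'))
    (N : ℕ) (κ κ' : Fin (d + 1)) (a b : Fib d) :
    BiStencilZeroMode.zmode N (fun κ₁ u₁ κ₂ u₂ => comp (comp (trK (psiKS r n)) (slotPsiS r n (slotPsiS r n T κ₁ u₁) κ₂ u₂)) (psiKS r n)) κ κ' a b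
      = BiStencilZeroMode.zmode N T κ κ' a b := by
  unfold BiStencilZeroMode.zmode
  exact Finset.sum_congr rfl fun c _ => inner_fourSlot_eq hn hr hT hδT hTcov κ (toSite c) κ' a b

/-- [folklore] **RIGHT-FIRST BRACKETING** (the table of `CombLin4Transport.lin4_conj_psiKS'` ∕ `PsiTableDefectOfDivergences`): the same with
`𝒯₄ T κ₁ u₁ κ₂ u₂ := Ψ̂ᵀ ∘ (slotPsiS r n (slotPsiS r n T κ₁ u₁) κ₂ u₂ ∘ Ψ̂)` (tame re-association of each localised slice). -/
theorem zmode_fourSlot_eq' {r : Fin (d + 1) → ℕ} (hr : r ∈ box (d + 1) n) (hT : LocStencil₂ T CT δT) (hδT : 0 < δT)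
    (hTcov : ∀ κ u κ' u' t, T κ (u + (n : ℤ) • t) κ' (u' + (n : ℤ) • t) = shiftK (-((n : ℤ) • t)) (T κ u κ' u'))
    (N : ℕ) (κ κ' : Fin (d + 1)) (a b : Fib d) :
    BiStencilZeroMode.zmode N (fun κ₁ u₁ κ₂ u₂ => comp (trK (psiKS r n)) (comp (slotPsiS r n (slotPsiS r n T κ₁ u₁) κ₂ u₂) (psiKS r n))) κ κ' a b
      = BiStencilZeroMode.zmode N T κ κ' a b := by
  have hΨ := SymCorrectorKernel.spr_psiKS hn hr
  have hP₂ := SymCorrectorSockets.locStencil₂_slotPsiS₂ hn r hT hδT.le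
  have e : (fun κ₁ u₁ κ₂ u₂ => comp (trK (psiKS r n)) (comp (slotPsiS r n (slotPsiS r n T κ₁ u₁) κ₂ u₂) (psiKS r n)))
      = fun κ₁ u₁ κ₂ u₂ => comp (comp (trK (psiKS r n)) (slotPsiS r n (slotPsiS r n T κ₁ u₁) κ₂ u₂)) (psiKS r n) := by
    funext κ₁ u₁ κ₂ u₂
    have hL : TameKernelCalculus.Loc (slotPsiS r n (slotPsiS r n T κ₁ u₁) κ₂ u₂) := ⟨_, _, _, _, hδT, hP₂ κ₁ u₁ κ₂ u₂⟩
    exact TameKernelCalculus.comp_assoc_tame hΨ.trK.tame hL.tame hΨ.tame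
  rw [e]
  exact zmode_fourSlot_eq hn hr hT hδT hTcov N κ κ' a b

end Tables

end Summit.QuantumFields.BalabanUV.Beta.GAN24.SymCorrectorZeroMode

end
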